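import Summits.AnomalousDissipation.AnomalousDissipation.Theses.ImpulseGrid

/-!
# AnomalousDissipation / ImpulseGrid — support item `GridThesisGlue`

Route `AnomalousDissipation/ImpulseGrid`, item stmt-AnomalousDissipation-14351 (`GridThesisGlue`,
support, rank 9): the proof-path glue `BoundedEnergyNoLeakGrid → GridSignsLaw → GridThesis`.

Proof (pure logic plus a tail shift): take the design `(Φ, Ψ, G, c)` and its clauses from
`GridSignsLaw`; the ten hypotheses of `BoundedEnergyNoLeakGrid` are a sub-list of those clauses, so
applying it at that design yields a vanishing-viscosity Leray–Hopf family `(ν, u₀, u)` with drift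
data, per-`j` sup-energy bounds, a uniform mean-energy bound `E` and no leakage; the law applied to
that family returns `η > 0`, a generalized limit `Λ` and a threshold `J` beyond which both grid sign
conditions hold.  Reindexing the family by `j ↦ j + J` keeps `ν → 0`
(`Filter.tendsto_add_atTop_nat`) and every other clause of `GridThesis` is a pointwise-in-`j`
instance of a hypothesis already in hand.

Nothing about Navier–Stokes is used: the solutions enter only through the two hypotheses.
-/

-- `Summit.<Summit>.<Problem>` is the tree's mandated summit-side namespace (CONVENTIONS §2); for this
-- single-conjunct summit the two coincide, so the duplicate is deliberate.
set_option linter.dupNamespace false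

namespace Summit.AnomalousDissipation.AnomalousDissipation.Theorems

open Summit.AnomalousDissipation.AnomalousDissipation.Theses.ImpulseGrid

/-- Settles stmt-AnomalousDissipation-14351 (support item `GridThesisGlue` of route ImpulseGrid):
`BoundedEnergyNoLeakGrid → GridSignsLaw → GridThesis`.  Design `(Φ, Ψ, G, c)` from the law, family
`(ν, u₀, u)` with energy bound `E` from `BoundedEnergyNoLeakGrid` at that design, `(η, Λ, J)` from
the law applied to the family, then shift the index by `J`. [folklore] -/
theorem gridThesisGlue_proof : GridThesisGlue := by
  unfold GridThesisGlue
  intro hBE hLaw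
  obtain ⟨Φ, Ψ, G, c, hΦ, hΨ, hG, hΦper, hΦmass, hΨper, hGper, hG0, hGdiv, hΨderiv, hΦΨG, hfs,
    hfdiv, hfmean, hc, hlaw⟩ := hLaw
  obtain ⟨ν, u₀, u, hνpos, hν0, hLH, hsupE, hdrift, ⟨E, hE⟩, hnoleak⟩ :=
    hBE Φ G c hΦ hG hΦper hΦmass hGper hG0 hfs hfdiv hfmean hc
  obtain ⟨η, hη, Λ, J, hJ⟩ := hlaw ν u₀ u E hνpos hν0 hLH hsupE hdrift hE
  refine ⟨Φ, Ψ, G, c, η, Λ, hΦ, hΨ, hG, hΨper, hGper, hG0, hGdiv, hΨderiv, hΦΨG, hfs, hfdiv,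
    hfmean, hc, hη, fun j => ν (j + J), fun j => u₀ (j + J), fun j => u (j + J),
    fun j => hνpos _, hν0.comp (Filter.tendsto_add_atTop_nat J), fun j => hLH _,
    fun j => hsupE _, fun j => hdrift _, ⟨E, fun j => hE _⟩, fun j => hnoleak _,
    fun j => (hJ (j + J) (Nat.le_add_left J j)).1,
    fun j => (hJ (j + J) (Nat.le_add_left J j)).2⟩

end Summit.AnomalousDissipation.AnomalousDissipation.Theorems
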